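import Summits.HodgeConjecture.HodgeConjecture.Theorems.H413SpectrumInterfaces
import Literature.NumberTheory.Rogawski1990.CohomologicalFinComponentIsTheta
import Literature.NumberTheory.Automorphic.Liu2021.Def411WeilCarriersAtLineClassTransport
import Literature.NumberTheory.Automorphic.HeckeRelatedOfIntertwiner
import Summits.HodgeConjecture.HodgeCM.Model.GSAdaptedFrame
import HarnessLib

/-!
# Crux `H413` — THE THETA PIN BRIDGE of programme P2: from the engine letter (C) «the finite component of an `H¹`-cohomological
# discrete automorphic `Π` of `U(V)` is `ω(μ, ε_a, χ)_f`» to the crux currency «`∃ K t`, `t` weight-one, `t.ε` global, `HeckeRelatedAt K σ (rhoTriple (datum413 …) t)`»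

HC_CM is proved only modulo the 7 printed citations until rung 0 closes.

F0P2-p02 (g0), 2026-08-30 (F0P2-plan (g0) RULING 22:16:17Z (3) «p02 — (C′) now; then the BRIDGE `Theorems/H413ThetaPinBridge.lean`»; interface `hB` of
F0P2-p03 (g0) 22:29:35Z, token for token).  PROOF FILE (theorems only, no `def`, no `sorry`) for crux item `stmt-HodgeConjecture-24833`; it is the last
binder `hB` of p03's fold `stubU2_of_letters … : SpectrumInterfaces.StubU2CohFormsSpectrumIsThetaAt` (stub U2′ of the line of record
`Cruxes/H413/Lines/P2ThetaDictionaryExists.lean`).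

WHAT IS PROVED.  `spectrumIsTheta_of_cohFinComponent (hC : Rogawski1990.cohFinComponent_isTheta) (hC′ : Def411WeilCarriers.rhoAtLine_lineClassTransport)`:
for every face of the floor (`hDel, F, h6, V, a₀, Φ, hΦ, i`), every automorphic `μ`, every irreducible smooth `σ` of `U(V)(𝔸_{F⁺,f})` and every discrete
automorphic `Π ≤ L²(U(V)(F⁺)\U(V)(𝔸_{F⁺}), μ)` that is `H¹`-cohomological at the factor of record (`IsHolCotangentAt ∨ IsAntiholCotangentAt` for
`(archFactorOf F V).ιinf ∕ .Kc`) and contains `σ` (`HasFinComponent`): there are a compact open `K ≤ U(V)(𝔸_{F⁺,f})` and an adèlic oscillator triple `t`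
of the PRINTED datum `datum413 hDel F V a₀ Φ i` with `μ_t` of weight one and `ε_t` GLOBAL such that `σ` and `ω_t = rhoTriple (datum413 …) t` are
HECKE-RELATED at level `K`.  Steps (all over ★ tree declarations):
1. (C) ★ `Rogawski1990.cohFinComponent_isTheta` APPLIED AT THE PIN — `L := K F`, `ι := ι₁`, `H := Hm V`, frame `T := V.sylvesterFrame` with
   `hT := HodgeCM.Model.sylvesterFrame_J V`, definiteness `V.posDef_of_ne`, `2 ≤ [F⁺:ℚ]` from `6 ≤ [F:ℚ]`, ω-side `e₁`, `dV := frameD V` (`frameD_real`,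
   `frameD_ne`), `g := frameG V` with `frame_congr V`, `ιV := ιVE V` pinned by ★ `coe_finFrameCongr` — gives `μc` conjugate symplectic of weight one, a line
   `a`, a character `χ` and an INJECTIVE intertwiner `f : σ ↪ rhoAtLine … (ιVE V) a χ` (`(archFactorOf F V).ιinf ∕ .Kc` ARE `cmArchSection ∕ cmCompactFactor …`
   and the crux carriers ARE the Literature carriers, by `rfl`);
2. the triple `t := ⟨μc, hμc, locF a, χ⟩` of `datum413 …`; `IsGlobalEps` by the Def. 4.12 element `e := a · (2δ)⁻¹` (★ `epsOf_algebraMap_mul`; `isGlobal_line`);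
3. (C′) `rhoAtLine_lineClassTransport` moves `⟨a⟩` to the pin's representative line `⟨r (locF a)⟩` (`r` = the datum's faithful section `Rep.update … Rep.ofLineOf …`,
   same finite classes by `Rep.locF_toFun`): `rhoTriple (datum413 …) t` IS `rhoAtLine … (ιVE V) (r.toFun (locF a)) χ` by `rfl`; compose (`IntertwiningMap.comp`);
4. ★ `Literature…exists_heckeRelated_of_intertwiningMap` at the compact open integral level (★ `finAdelicIntegralLevel`) ⇒ `HeckeRelatedAt` (its `∃`-body verbatim).

Sources: [Liu2021, Def. 4.11–4.12, proof of Prop. 4.13 l. 2140–2146, App. D §D.1]; [Rogawski1990, Thm. 13.3.6 (c), §15.3]; [GelbartRogawski1991, Thm. 5.1.1,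
Lem. 5.1.2]; [BushnellHenniart2006, §4.2–4.3]; [HarrisKudlaSweet1996, §1]; [Jacobowitz1962, Thm. 3.1].
-/

set_option autoImplicit false

-- the mandated namespace has the single-problem summit's repeated segment (`HodgeConjecture.HodgeConjecture`), as in every `Cruxes/…` module of this sub-problem
set_option linter.dupNamespace false

noncomputable section

namespace Summit.HodgeConjecture.HodgeConjecture.Cruxes.H413.ThetaPinBridge

open scoped TensorProduct Matrix
open NumberField NumberField.InfinitePlace IsDedekindDomain MeasureTheory
open HodgeCM.Model HodgeCM.Model.LiuIndex HodgeCM.Model.TowerCarrier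
open Summit.HodgeConjecture.CorCM.Model
open Literature.AlgebraicGeometry.Motives (CMType AbelianVariety)
open Literature.AlgebraicGeometry.HodgeTheory Literature.NumberTheory.Automorphic.PicardCM
open Literature.AlgebraicGeometry.ShimuraVarieties Literature.AlgebraicGeometry.ShimuraVarieties.UnitaryCanonicalModel
open Literature.NumberTheory.ComplexMultiplication
open Literature.NumberTheory.Automorphic
open Literature.NumberTheory.Automorphic.Liu2021 Literature.NumberTheory.Automorphic.Liu2021.AppendixC
open Literature.NumberTheory.Automorphic.Liu2021.Def411WeilCarriers
open Literature.NumberTheory.Automorphic.Liu2021.Def411WeilCarriersDoubling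
open Literature.NumberTheory.Automorphic.IdeleClassGroup
open Literature.NumberTheory.GelbartRogawski1991 Literature.NumberTheory.GelbartRogawski1991.UnitaryDualPair
open Literature.RepresentationTheory Literature.RepresentationTheory.Liu2021
open Literature.NumberTheory.Rogawski1990
open Summit.HodgeConjecture.CorCM
open Summit.HodgeConjecture.CorCM.Transposition
open Summit.HodgeConjecture.CorCM.Transposition.OmegaTransport (realUnit)
open HodgeCM.Model.ArchSideTerm (e₁)
open Literature.NumberTheory.GelbartRogawski1991.OscillatorTripleDictionary (OccursInH1 IsIsoToOmega rhoTriple)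
open MulAction
open Literature.Geometry.ComplexHyperbolic.BallModel (U21 x₀)
open Summit.HodgeConjecture.CorCM.Lines.A3Liu413 (datum413)
open Summit.HodgeConjecture.HodgeConjecture.Cruxes.H413.CohFormsCarriers
open Summit.HodgeConjecture.HodgeConjecture.Cruxes.H413.SpectrumInterfaces

/-! ## §1  Generic helpers (no pin) -/

section Helpers

variable (L : Type) [Field L] [NumberField L] [IsCMField L]

/-- `δ′ := (2δ)⁻¹ ≠ 0` for the imaginary unit `δ = imagUnit L`. [cite: Liu2021, Def. 4.12 (l. 2105)] -/
theorem two_mul_imagUnit_inv_ne_zero : (2 * imagUnit L)⁻¹ ≠ 0 :=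
  inv_ne_zero (mul_ne_zero two_ne_zero (imagUnit_ne_zero L))

/-- `δ′ = (2δ)⁻¹` is purely imaginary: `δ̄′ = −δ′`. [cite: Liu2021, Def. 4.12 (l. 2105)] -/
theorem complexConj_two_mul_imagUnit_inv :
    IsCMField.complexConj L (2 * imagUnit L)⁻¹ = -(2 * imagUnit L)⁻¹ := by
  rw [map_inv₀, map_mul, map_ofNat, complexConj_imagUnit, mul_neg, inv_neg]

/-- **The Def. 4.12 element of a line is GLOBAL**: for `a ∈ (L⁺)ˣ` the element `e := a · (2δ)⁻¹ ∈ L^{×−}` is non-zero, purely imaginary, and its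
collection in the `(2δ)⁻¹`-normalisation is `locF a` (★ `epsOf_algebraMap_mul`). [cite: Liu2021, Def. 4.12 (l. 2102–2108)] -/
theorem isGlobal_line (a : (↥(maximalRealSubfield L))ˣ) :
    ∃ e : L, e ≠ 0 ∧ IsCMField.complexConj L e = -e ∧
      epsOf (↥(maximalRealSubfield L)) (imagUnitSq L) L (2 * imagUnit L)⁻¹ e =
        locF (↥(maximalRealSubfield L)) (imagUnitSq L) a := by
  refine ⟨algebraMap (↥(maximalRealSubfield L)) L a * (2 * imagUnit L)⁻¹, ?_, ?_,
    epsOf_algebraMap_mul (↥(maximalRealSubfield L)) (imagUnitSq L) L (2 * imagUnit L)⁻¹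
      (two_mul_imagUnit_inv_ne_zero L) a⟩
  · refine mul_ne_zero ?_ (two_mul_imagUnit_inv_ne_zero L)
    exact (map_ne_zero_iff _ (algebraMap (↥(maximalRealSubfield L)) L).injective).mpr a.ne_zero
  · have ha : IsCMField.complexConj L (algebraMap (↥(maximalRealSubfield L)) L a) =
        algebraMap (↥(maximalRealSubfield L)) L a :=
      IsCMField.complexConj_apply_eq_self (K := L) (a : ↥(maximalRealSubfield L))
    rw [map_mul, ha, complexConj_two_mul_imagUnit_inv, mul_neg]

/-- **(C′) at a faithful representative section**: for any `r : Rep L⁺ d` (`locF (r ε) = ε` on global `ε`), `ω(μ, ε_a, χ)_f` at `⟨a⟩` embeds into its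
realisation at the representative line `⟨r (locF a)⟩` — `rhoAtLine_lineClassTransport` with `h := (r.locF_toFun (locF a) ⟨a, rfl⟩).symm`.
[cite: Liu2021, App. D §D.1 Step 1 footnote (l. 5215)] [cite: Jacobowitz1962, Thm. 3.1] -/
theorem exists_intertwiner_repLine (hC' : rhoAtLine_lineClassTransport) {N' n' : ℕ} (e : Fin N' × Fin 1 ≃ Fin n')
    (dV : Fin N' → L) (hdV : ∀ i, IsCMField.complexConj L (dV i) = dV i) (hdV0 : ∀ i, dV i ≠ 0)
    (χV : Literature.NumberTheory.GaloisRepresentations.HeckeCharacter L) (hχu : χV.IsUnitary)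
    (hχs : Literature.RepresentationTheory.HarrisKudlaSweet1996.IsSplittingChar L 1 χV)
    {G : Type} [Group G] [TopologicalSpace G]
    (ιV : G →* UnitaryGroup.finAdelic (↥(maximalRealSubfield L)) L (IsCMField.complexConj L) N' (Matrix.diagonal dV))
    (χ : Chi (↥(maximalRealSubfield L)) L (IsCMField.complexConj L))
    (r : Rep (↥(maximalRealSubfield L)) (imagUnitSq L)) (a : (↥(maximalRealSubfield L))ˣ) :
    ∃ e' : (rhoAtLine (↥(maximalRealSubfield L)) L (IsCMField.complexConj L) N' e (Matrix.diagonal dV)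
              (complexConj_imagUnit L) (imagUnit_ne_zero L) (imagUnit_mul_self L) (realDiagonal_isSymm L dV hdV)
              (isUnit_det_realDiagonal L dV hdV hdV0) (realDiagonal_map L dV hdV).symm
              (fun b => isCompatible_chiSplittingLine L e dV hdV hdV0 χV hχu hχs
                (TW (↥(maximalRealSubfield L)) b) (isSymm_TW (↥(maximalRealSubfield L)) b)
                (isUnit_det_TW (↥(maximalRealSubfield L)) b) (JW (↥(maximalRealSubfield L)) L b)
                (JW_eq (↥(maximalRealSubfield L)) L b))
              ιV a χ).IntertwiningMap
            (rhoAtLine (↥(maximalRealSubfield L)) L (IsCMField.complexConj L) N' e (Matrix.diagonal dV)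
              (complexConj_imagUnit L) (imagUnit_ne_zero L) (imagUnit_mul_self L) (realDiagonal_isSymm L dV hdV)
              (isUnit_det_realDiagonal L dV hdV hdV0) (realDiagonal_map L dV hdV).symm
              (fun b => isCompatible_chiSplittingLine L e dV hdV hdV0 χV hχu hχs
                (TW (↥(maximalRealSubfield L)) b) (isSymm_TW (↥(maximalRealSubfield L)) b)
                (isUnit_det_TW (↥(maximalRealSubfield L)) b) (JW (↥(maximalRealSubfield L)) L b)
                (JW_eq (↥(maximalRealSubfield L)) L b))
              ιV (r.toFun (locF (↥(maximalRealSubfield L)) (imagUnitSq L) a)) χ),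
        Function.Injective e' :=
  hC' L e dV hdV hdV0 χV hχu hχs ιV χ a (r.toFun (locF (↥(maximalRealSubfield L)) (imagUnitSq L) a))
    (r.locF_toFun _ ⟨a, rfl⟩).symm

/-- Composition of injective intertwiners is an injective intertwiner (Mathlib `Representation.IntertwiningMap.comp`). [cite: BushnellHenniart2006, §4.3] -/
theorem exists_injective_comp {k G V₁ V₂ V₃ : Type*} [CommSemiring k] [Monoid G] [AddCommMonoid V₁] [AddCommMonoid V₂] [AddCommMonoid V₃]
    [Module k V₁] [Module k V₂] [Module k V₃] {ρ₁ : Representation k G V₁} {ρ₂ : Representation k G V₂} {ρ₃ : Representation k G V₃}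
    (f : ρ₁.IntertwiningMap ρ₂) (hf : Function.Injective f) (g : ρ₂.IntertwiningMap ρ₃) (hg : Function.Injective g) :
    ∃ h : ρ₁.IntertwiningMap ρ₃, Function.Injective h :=
  ⟨g.comp f, fun x y hxy => hf (hg (by simpa using hxy))⟩

/-- `2 ≤ [F⁺ : ℚ]` when `6 ≤ [F : ℚ]` for a CM field `F` (`[F : ℚ] = 2 [F⁺ : ℚ]`). [cite: Liu2021, proof of Prop. 4.13 (l. 2140)] -/
theorem two_le_finrank_maximalRealSubfield (h6 : 6 ≤ Module.finrank ℚ L) :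
    2 ≤ Module.finrank ℚ ↥(maximalRealSubfield L) := by
  have hmul := Module.finrank_mul_finrank ℚ ↥(maximalRealSubfield L) L
  rw [Algebra.IsQuadraticExtension.finrank_eq_two ↥(maximalRealSubfield L) L] at hmul
  omega

end Helpers

/-! ## §2  The bridge at the pin -/

set_option synthInstance.maxHeartbeats 400000 in
set_option maxHeartbeats 8000000 in
/-- **THE THETA PIN BRIDGE (programme P2, binder `hB` of `stubU2_of_letters`).**  Under the engine letter (C) ★ `cohFinComponent_isTheta` and the line-class
transport (C′) `rhoAtLine_lineClassTransport`: for every face, every automorphic `μ`, every irreducible smooth `σ` of `U(V)(𝔸_{F⁺,f})` and every discrete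
automorphic `Π` that is `H¹`-cohomological of type `(1,0)` or `(0,1)` at the factor of record and has finite component `σ`, there are a compact open `K`
and a triple `t` of the PRINTED datum with `μ_t` of weight one, `ε_t` global, and `σ`, `ω_t` Hecke-related at level `K`.  (C) is applied at the pin
(`K F, ι₁, Hm V, V.sylvesterFrame, sylvesterFrame_J V, V.posDef_of_ne, 2 ≤ [F⁺:ℚ], e₁, frameD V, frameG V, frame_congr V, ιVE V` with ★ `coe_finFrameCongr`),
`t := ⟨μc, hμc, locF a, χ⟩`, globality by `isGlobal_line`, the line is moved to the datum's representative by (C′) (`exists_intertwiner_repLine` at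
`r := Rep.update … Rep.ofLineOf …`, where `rhoTriple (datum413 …) t` is that realisation by `rfl`), and the injective composite yields `HeckeRelatedAt` at the
compact open `finAdelicIntegralLevel ∩ Stab` (★ `exists_heckeRelated_of_intertwiningMap`). [cite: Liu2021, Def. 4.11–4.12; proof of Prop. 4.13 l. 2140–2146; App. D Lem. D.1]
[cite: Rogawski1990, Thm. 13.3.6; §15.3] [cite: GelbartRogawski1991, Thm 5.1.1 p. 465; Lemma 5.1.2 p. 466] [cite: BushnellHenniart2006, §4.2–4.3] -/
theorem spectrumIsTheta_of_cohFinComponent (hC : cohFinComponent_isTheta) (hC' : rhoAtLine_lineClassTransport) :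
    ∀ (hDel : canonicalModel_exists_printed) (F : HodgeCM.CMField) [IsGalois ℚ F] (h6 : 6 ≤ Module.finrank ℚ F) {ι₁ : F →+* ℂ}
      (V : HodgeCM.HermSpace3 F ι₁) (a₀ : RealScalar F) (Φ : CMType F) (hΦ : ι₁ ∈ Φ.1) (i : I V (repAt a₀) (muLiu ι₁ GramClass.rep))
      (μ : Measure (adelicDatum F V).automorphicQuotient) [(adelicDatum F V).IsAutomorphicMeasure μ]
      (W : Type) [AddCommGroup W] [Module ℂ W] (σ : Representation ℂ ↥(HodgeCM.HermSpace3.adelicFin V) W),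
      σ.IsIrreducible → σ.IsSmooth →
        ∀ P : DiscreteAutomorphicRep (adelicDatum F V) μ,
          (P.IsHolCotangentAt (archFactorOf F V).ιinf (archFactorOf F V).Kc ∨
              P.IsAntiholCotangentAt (archFactorOf F V).ιinf (archFactorOf F V).Kc) →
            P.HasFinComponent σ →
              ∃ K : Subgroup ↥(HodgeCM.HermSpace3.adelicFin V),
                IsOpen (K : Set ↥(HodgeCM.HermSpace3.adelicFin V)) ∧ IsCompact (K : Set ↥(HodgeCM.HermSpace3.adelicFin V)) ∧
                  ∃ t : (datum413 hDel F V a₀ Φ i).Triple, t.HasWeightOne ∧ IsGlobalEps (datum413 hDel F V a₀ Φ i) t.ε ∧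
                    HeckeRelatedAt K σ (rhoTriple (datum413 hDel F V a₀ Φ i) t) := by
  intro hDel F _ h6 ι₁ V a₀ Φ hΦ i μ _ W _ _ σ hirr hsm P hP hfin
  -- (1) the engine letter (C) at the pin
  have h2 : 2 ≤ Module.finrank ℚ ↥(maximalRealSubfield (HodgeCM.CMField.K F)) :=
    two_le_finrank_maximalRealSubfield (HodgeCM.CMField.K F) h6
  haveI : (UnitaryGroup.adelicGroupData (↥(maximalRealSubfield (HodgeCM.CMField.K F))) (HodgeCM.CMField.K F)
      (IsCMField.complexConj (HodgeCM.CMField.K F)) 3 (HodgeCM.HermSpace3.Hm V)).IsAutomorphicMeasure μ := ‹_›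
  obtain ⟨μc, hμc, hw, a, χ, f, hf⟩ :=
    hC (HodgeCM.CMField.K F) ι₁ (HodgeCM.HermSpace3.Hm V) V.sylvesterFrame (HodgeCM.Model.sylvesterFrame_J V) V.posDef_of_ne h2
      e₁ (frameD V) (frameD_real V) (frameD_ne V) (frameG V) (frame_congr V) (ιVE V)
      (fun k => coe_finFrameCongr (HodgeCM.CMField.K F) V.Hm (frameG V) (frameD V) (frame_congr V) k)
      μ W σ hirr hsm P hP hfin
  -- (2) the triple of the printed datum and the globality of its `ε`
  let t : (datum413 hDel F V a₀ Φ i).Triple :=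
    ⟨μc, hμc, locF (↥(maximalRealSubfield (HodgeCM.CMField.K F))) (imagUnitSq (HodgeCM.CMField.K F)) a, χ⟩
  have hglob : IsGlobalEps (datum413 hDel F V a₀ Φ i) t.ε := isGlobal_line (HodgeCM.CMField.K F) a
  -- (3) move the line to the datum's representative: `rhoTriple (datum413 …) t` is `rhoAtLine … (r.toFun (locF a)) χ` by `rfl`
  obtain ⟨e', he'⟩ := exists_intertwiner_repLine (HodgeCM.CMField.K F) hC' e₁ (frameD V) (frameD_real V) (frameD_ne V)
    (toHeckeCharacter (HodgeCM.CMField.K F) μc) (isUnitary_toHeckeCharacter (HodgeCM.CMField.K F) μc)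
    ((isOscillatorChar_toHeckeCharacter_iff μc).mpr hμc) (ιVE V) χ
    (Rep.update (↥(maximalRealSubfield (HodgeCM.CMField.K F))) (imagUnitSq (HodgeCM.CMField.K F))
      (Rep.ofLineOf (↥(maximalRealSubfield (HodgeCM.CMField.K F))) (imagUnitSq (HodgeCM.CMField.K F)))
      (locF (↥(maximalRealSubfield (HodgeCM.CMField.K F))) (imagUnitSq (HodgeCM.CMField.K F))
        (realUnit ⟨HodgeCM.CMField.K F⟩ (repAt a₀ (Sigma.fst i)).1 (repAt a₀ (Sigma.fst i)).2.1 (repAt a₀ (Sigma.fst i)).2.2))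
      (realUnit ⟨HodgeCM.CMField.K F⟩ (repAt a₀ (Sigma.fst i)).1 (repAt a₀ (Sigma.fst i)).2.1 (repAt a₀ (Sigma.fst i)).2.2) rfl)
    a
  obtain ⟨g, hg⟩ : ∃ g : σ.IntertwiningMap (rhoTriple (datum413 hDel F V a₀ Φ i) t), Function.Injective g :=
    exists_injective_comp f hf e' he'
  -- (4) Hecke-relatedness at a compact open level
  obtain ⟨K, hKo, hKc, hrel⟩ :=
    Literature.NumberTheory.Automorphic.exists_heckeRelated_of_intertwiningMap σ (rhoTriple (datum413 hDel F V a₀ Φ i) t)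
      (UnitaryGroup.finAdelicIntegralLevel (↥(maximalRealSubfield (HodgeCM.CMField.K F))) (HodgeCM.CMField.K F)
        (IsCMField.complexConj (HodgeCM.CMField.K F)) 3 (HodgeCM.HermSpace3.Hm V))
      (UnitaryGroup.isCompact_finAdelicIntegralLevel _ _ _ _ _) (UnitaryGroup.isOpen_finAdelicIntegralLevel _ _ _ _ _)
      hirr hsm g hg
  exact ⟨K, hKo, hKc, t, hw, hglob, hrel⟩

end Summit.HodgeConjecture.HodgeConjecture.Cruxes.H413.ThetaPinBridge

end
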